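import Mathlib

/-!
# `PolycrystalWulffBound`: open convex sets of finite volume are bounded (so `Poly` pieces are)

Route `StickyWulffConstant` of the venture `Summits/Ventures/Crystal3D`, crux `PolycrystalWulffBound`
(item `stmt-Ventures-19482`), second prover lane.  The P stub's polyhedral grains
(`Poly S : S = ⋃ i, ⋂ p ∈ H i, {⟪p.1, x⟫ < p.2}`) come with `volume S < ⊤` from the texture, while
the facet calculus (`PolytopeCalculus`, 19483) and the arrangement refinement
(`exists_disjoint_polytope_refinement`) want BOUNDED pieces.  The missing elementary fact:

* `ball_subset_of_convex` — if `ball x₀ r ⊆ S`, `y ∈ S`, `S` convex and `0 ≤ t < 1`, then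
  `ball (x₀ + t • (y − x₀)) ((1 − t) r) ⊆ S` (the cone over the ball with apex `y`);
* `isBounded_of_convex_isOpen_volume_lt_top` — an open convex set of finite Haar volume in a
  finite-dimensional real inner product space is bounded (an unbounded one contains, along the segment
  to a far point, arbitrarily many disjoint balls of radius `r/2`);
* `isBounded_hPolyhedron_of_volume_lt_top`, `isBounded_piece_of_volume_iUnion_lt_top` — hence every
  open H-polyhedron of finite volume, and every piece of a `Poly` set of finite volume, is bounded.
WHAT THIS IS NOT: anything on the crux beyond its polyhedral bookkeeping.
-/

noncomputable section

namespace Summit.Ventures.Crystal3D.Theorems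

open MeasureTheory Set Metric
open scoped RealInnerProductSpace ENNReal

variable {E : Type*} [NormedAddCommGroup E] [InnerProductSpace ℝ E] [FiniteDimensional ℝ E]
  [MeasurableSpace E] [BorelSpace E]

omit [FiniteDimensional ℝ E] [MeasurableSpace E] [BorelSpace E] in
/-- The cone over a ball inside a convex set: if `ball x₀ r ⊆ S`, `y ∈ S` and `0 ≤ t < 1`, then the
ball of radius `(1 − t) r` around `x₀ + t (y − x₀)` lies in `S`. -/
theorem ball_subset_of_convex {S : Set E} (hc : Convex ℝ S) {x₀ y : E} {r : ℝ}
    (hball : ball x₀ r ⊆ S) (hy : y ∈ S) {t : ℝ} (ht0 : 0 ≤ t) (ht1 : t < 1) :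
    ball (x₀ + t • (y - x₀)) ((1 - t) * r) ⊆ S := by
  intro z hz
  have h1t : 0 < 1 - t := sub_pos.2 ht1
  -- the point of the original ball that `z` comes from
  set w : E := x₀ + (1 - t)⁻¹ • (z - (x₀ + t • (y - x₀))) with hw
  have hwS : w ∈ S := by
    apply hball
    rw [mem_ball, dist_eq_norm, hw, add_sub_cancel_left, norm_smul, Real.norm_of_nonneg
      (inv_nonneg.2 h1t.le)]
    rw [mem_ball, dist_eq_norm] at hz
    calc (1 - t)⁻¹ * ‖z - (x₀ + t • (y - x₀))‖ < (1 - t)⁻¹ * ((1 - t) * r) :=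
          mul_lt_mul_of_pos_left hz (inv_pos.2 h1t)
      _ = r := by field_simp
  have hz_eq : z = (1 - t) • w + t • y := by
    rw [hw, smul_add, smul_smul, mul_inv_cancel₀ h1t.ne', one_smul]
    module
  rw [hz_eq]
  exact hc hwS hy h1t.le ht0 (by ring)

/-- **An open convex set of finite volume is bounded.** If `S` were unbounded, the segment from a
point `x₀` (with `ball x₀ r ⊆ S`) to a point `y ∈ S` at distance `≥ 4 r N` would carry `N` pairwise
disjoint balls of radius `r/2` inside `S`, so `volume S ≥ N · volume (ball 0 (r/2))` for every `N`. -/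
theorem isBounded_of_convex_isOpen_volume_lt_top {S : Set E} (hc : Convex ℝ S) (ho : IsOpen S)
    (hv : volume S < ⊤) : Bornology.IsBounded S := by
  rcases S.eq_empty_or_nonempty with h | ⟨x₀, hx₀⟩
  · rw [h]; exact Bornology.isBounded_empty
  obtain ⟨r, hr, hball⟩ := Metric.isOpen_iff.1 ho x₀ hx₀
  -- the volume of a ball of radius `r/2` (translation invariant, positive, finite)
  set c : ℝ≥0∞ := volume (ball (0 : E) (r / 2)) with hc_def
  have hc0 : c ≠ 0 := (measure_ball_pos volume (0 : E) (by positivity)).ne'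
  have hball_vol : ∀ x : E, volume (ball x (r / 2)) = c := fun x => by
    rw [hc_def, Measure.addHaar_ball_center]
  -- choose `N` with `volume S < N * c`
  obtain ⟨N, hN⟩ : ∃ N : ℕ, volume S < N * c := by
    obtain ⟨N, hN⟩ := ENNReal.exists_nat_gt (ENNReal.div_lt_top hv.ne hc0).ne
    refine ⟨N, ?_⟩
    rwa [ENNReal.div_lt_iff (Or.inl hc0) (Or.inl measure_ball_lt_top.ne)] at hN
  -- suppose `S` unbounded: a point `y ∈ S` with `dist y x₀ ≥ 4 r N`
  by_contra hS
  have hfar : ∃ y ∈ S, 4 * r * N ≤ dist y x₀ := by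
    by_contra hno
    push Not at hno
    apply hS
    refine (isBounded_closedBall (x := x₀) (r := 4 * r * N)).subset fun y hy => ?_
    rw [mem_closedBall]
    exact (hno y hy).le
  obtain ⟨y, hyS, hy⟩ := hfar
  set M : ℝ := dist y x₀ with hM
  have hN0 : 0 < (N : ℝ) := by
    have : (0 : ℝ≥0∞) < N * c := lt_of_le_of_lt (zero_le) hN
    have hN' : (N : ℝ≥0∞) ≠ 0 := by
      intro h0; rw [h0, zero_mul] at this; exact lt_irrefl _ this
    exact_mod_cast Nat.pos_of_ne_zero (by exact_mod_cast hN')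
  have hM0 : 0 < M := lt_of_lt_of_le (by positivity) hy
  -- the `N` balls
  set ctr : Fin N → E := fun j => x₀ + ((2 * r * j) / M) • (y - x₀) with hctr
  have ht_le : ∀ j : Fin N, (2 * r * (j : ℕ)) / M ≤ 1 / 2 := by
    intro j
    rw [div_le_iff₀ hM0]
    have hj : ((j : ℕ) : ℝ) ≤ N - 1 := by
      have := j.2
      have : ((j : ℕ) : ℝ) + 1 ≤ N := by exact_mod_cast this
      linarith
    nlinarith
  have hsub : ∀ j : Fin N, ball (ctr j) (r / 2) ⊆ S := by
    intro j
    have ht0 : 0 ≤ (2 * r * (j : ℕ)) / M := by positivity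
    have ht1 : (2 * r * (j : ℕ)) / M < 1 := lt_of_le_of_lt (ht_le j) (by norm_num)
    refine (ball_subset_ball ?_).trans (ball_subset_of_convex hc hball hyS ht0 ht1)
    have := ht_le j
    nlinarith
  have hyx : ‖y - x₀‖ = M := by rw [hM, dist_eq_norm]
  have hdisj : Pairwise fun j j' : Fin N => Disjoint (ball (ctr j) (r / 2)) (ball (ctr j') (r / 2)) := by
    intro j j' hjj'
    apply ball_disjoint_ball
    have hdist : dist (ctr j) (ctr j') = 2 * r * |((j : ℕ) : ℝ) - ((j' : ℕ) : ℝ)| := by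
      rw [hctr, dist_eq_norm]
      simp only
      rw [add_sub_add_left_eq_sub, ← sub_smul, norm_smul, hyx, Real.norm_eq_abs, ← sub_div, abs_div,
        abs_of_pos hM0, div_mul_cancel₀ _ hM0.ne', ← mul_sub, abs_mul,
        abs_of_pos (by positivity : (0 : ℝ) < 2 * r)]
    rw [hdist]
    have hne : ((j : ℕ) : ℝ) ≠ ((j' : ℕ) : ℝ) := by
      intro h
      exact hjj' (Fin.ext (by exact_mod_cast h))
    have h1 : (1 : ℝ) ≤ |((j : ℕ) : ℝ) - ((j' : ℕ) : ℝ)| := by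
      rcases lt_or_gt_of_ne hne with h | h
      · rw [abs_of_neg (sub_neg.2 h)]
        have : (j : ℕ) < (j' : ℕ) := by exact_mod_cast h
        have : ((j : ℕ) : ℝ) + 1 ≤ ((j' : ℕ) : ℝ) := by exact_mod_cast this
        linarith
      · rw [abs_of_pos (sub_pos.2 h)]
        have : (j' : ℕ) < (j : ℕ) := by exact_mod_cast h
        have : ((j' : ℕ) : ℝ) + 1 ≤ ((j : ℕ) : ℝ) := by exact_mod_cast this
        linarith
    nlinarith
  -- volume count
  have hvol : (N : ℝ≥0∞) * c ≤ volume S := by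
    have h2 : volume (⋃ j, ball (ctr j) (r / 2)) = ∑ j : Fin N, volume (ball (ctr j) (r / 2)) := by
      rw [measure_iUnion hdisj (fun j => measurableSet_ball), tsum_fintype]
    calc (N : ℝ≥0∞) * c = ∑ j : Fin N, volume (ball (ctr j) (r / 2)) := by
          simp only [hball_vol, Finset.sum_const, Finset.card_univ, Fintype.card_fin, nsmul_eq_mul]
      _ = volume (⋃ j, ball (ctr j) (r / 2)) := h2.symm
      _ ≤ volume S := measure_mono (iUnion_subset hsub)
  exact absurd (lt_of_lt_of_le hN hvol) (lt_irrefl _)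

/-- An open H-polyhedron `⋂_{p ∈ H} {⟪p.1, x⟫ < p.2}` of finite volume is bounded. -/
theorem isBounded_hPolyhedron_of_volume_lt_top (H : Finset (E × ℝ))
    (hv : volume (⋂ p ∈ H, {x : E | ⟪p.1, x⟫ < p.2}) < ⊤) :
    Bornology.IsBounded (⋂ p ∈ H, {x : E | ⟪p.1, x⟫ < p.2}) := by
  refine isBounded_of_convex_isOpen_volume_lt_top ?_ ?_ hv
  · refine convex_iInter₂ fun p _ => ?_
    exact convex_halfSpace_lt (innerSL ℝ p.1).isLinear p.2
  · refine isOpen_biInter_finset fun p _ => ?_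
    exact isOpen_lt (continuous_const.inner continuous_id) continuous_const

/-- Every piece of a polyhedral set `⋃ i, ⋂_{p ∈ H i} {⟪p.1, x⟫ < p.2}` of finite volume is bounded. -/
theorem isBounded_piece_of_volume_iUnion_lt_top {k : ℕ} (H : Fin k → Finset (E × ℝ))
    (hv : volume (⋃ i, ⋂ p ∈ H i, {x : E | ⟪p.1, x⟫ < p.2}) < ⊤) (i : Fin k) :
    Bornology.IsBounded (⋂ p ∈ H i, {x : E | ⟪p.1, x⟫ < p.2}) :=
  isBounded_hPolyhedron_of_volume_lt_top (H i)
    (lt_of_le_of_lt (measure_mono (subset_iUnion (fun i => ⋂ p ∈ H i, {x : E | ⟪p.1, x⟫ < p.2}) i))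
      hv)

end Summit.Ventures.Crystal3D.Theorems

end
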